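import Mathlib.AlgebraicGeometry.ResidueField
import Mathlib.AlgebraicGeometry.Pullbacks
import Mathlib.RingTheory.Localization.Away.Basic
import Mathlib.RingTheory.LocalRing.ResidueField.Ideal
import HarnessLib

/-!
# The fibre over `𝔭` after the base change `A → A_g`: same fibre, presented over the same `κ(𝔭)`

Topic `AlgebraicGeometry/Morphisms`; namespace `Literature.AlgebraicGeometry.Morphisms`. THEOREMS ONLY (no definition, no named
fact, no instance, no `sorry`).

Let `f : X → Spec A`, `𝔭 ∈ Spec A`, `g ∉ 𝔭`, `A_g = Localization.Away g`, and let the fibre `X₀ = X ×_A κ(𝔭)` be given by a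
cartesian square over `Spec (A → κ(𝔭))`, `κ(𝔭) = 𝔭.asIdeal.ResidueField`. After the base change `X₁ = X ×_A A_g → Spec A_g`
the fibre over the prime `𝔭₁ = 𝔭A_g` is AGAIN `X₀`, and — which is the point — it can be presented over the SAME field `κ(𝔭)`:

* `isUnit_algebraMap_residueField_of_not_mem` — `g` is a unit in `κ(𝔭)`, so `A_g → κ(𝔭)` exists
  (Mathlib `IsLocalization.Away.lift`); `SpecMap_awayLift_comp` — `Spec κ(𝔭) → Spec A_g → Spec A` is `Spec κ(𝔭) → Spec A`;
* **`isPullback_fibre_awayBaseChange`** — the square `X₀ → X₁ = X ×_A A_g`, `X₀ → Spec κ(𝔭) → Spec A_g` is cartesian;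
* `exists_primeSpectrum_away_comap_eq` — the prime `𝔭₁` of `A_g` under `𝔭`;
* **`exists_residueField_factor_awayLift`** — `Spec κ(𝔭₁) → Spec A_g` factors through `Spec κ(𝔭) → Spec A_g`
  (`κ(𝔭) → κ(𝔭₁)` is Mathlib `Ideal.ResidueField.map`; in fact an isomorphism, not needed here).

This is exactly the input shape `(K := κ(𝔭), σ, hσ, HX)` of ★ `Morphisms/RelativelyVeryAmpleNearFibre` § OverAlgebra /
★ `Morphisms/ClosedImmersionNearFibreFlexible` over the base `A_g`: in the proof of EGA III 4.7.1 one first shrinks `Spec A` to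
`Spec A_g` (sections lift / generate there) and then applies 4.6.7 (ii) at `𝔭A_g` with the ORIGINAL fibre datum. Count-neutral
capital of the cell `hodgecm-mathlib`, (h2) leaf (B) (HC_CM is proved only modulo the 7 printed citations until rung 0 closes).

## References
* A. Grothendieck, J. Dieudonné, *EGA III₁* (1961), Prop. 4.6.7 (ii), Thm. 4.7.1 (the reduction to a smaller affine base).
  [EGAIII1]
-/

universe u

open CategoryTheory CategoryTheory.Limits AlgebraicGeometry TopologicalSpace

namespace Literature.AlgebraicGeometry.Morphisms

section Away

variable {A : Type u} [CommRing A] (𝔭 : PrimeSpectrum A) (g : A)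

/-- `g ∉ 𝔭` ⇒ the image of `g` in the residue field `κ(𝔭)` is a unit. [cite: EGAIII1, Prop. 4.6.7 (ii)] -/
theorem isUnit_algebraMap_residueField_of_not_mem (hg : g ∉ 𝔭.asIdeal) :
    IsUnit (algebraMap A 𝔭.asIdeal.ResidueField g) := by
  rw [isUnit_iff_ne_zero, ne_eq, Ideal.algebraMap_residueField_eq_zero]
  exact hg

/-- `Spec κ(𝔭) → Spec A_g → Spec A` (through `A_g → κ(𝔭)`, Mathlib `IsLocalization.Away.lift`) is `Spec κ(𝔭) → Spec A`.
[cite: EGAIII1, Prop. 4.6.7 (ii)] -/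
theorem SpecMap_awayLift_comp (hg : g ∉ 𝔭.asIdeal) :
    Spec.map (CommRingCat.ofHom (IsLocalization.Away.lift g (S := Localization.Away g)
        (isUnit_algebraMap_residueField_of_not_mem 𝔭 g hg))) ≫
      Spec.map (CommRingCat.ofHom (algebraMap A (Localization.Away g))) =
      Spec.map (CommRingCat.ofHom (algebraMap A 𝔭.asIdeal.ResidueField)) := by
  rw [← Spec.map_comp, ← CommRingCat.ofHom_comp, IsLocalization.Away.lift_comp]

/-- **The fibre of `X ×_A A_g` over `𝔭A_g`, presented over `κ(𝔭)`.** If `X₀ → X`, `X₀ → Spec κ(𝔭)` is a cartesian square over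
`Spec (A → κ(𝔭))`, then `X₀ → X ×_A A_g` (the induced morphism), `X₀ → Spec κ(𝔭)` is a cartesian square over
`Spec (A_g → κ(𝔭))`. [cite: EGAIII1, Prop. 4.6.7 (ii)] -/
theorem isPullback_fibre_awayBaseChange (hg : g ∉ 𝔭.asIdeal) {X X₀ : Scheme.{u}} (f : X ⟶ Spec (.of A))
    {iX : X₀ ⟶ X} {f₀ : X₀ ⟶ Spec (.of 𝔭.asIdeal.ResidueField)}
    (HX : IsPullback iX f₀ f (Spec.map (CommRingCat.ofHom (algebraMap A 𝔭.asIdeal.ResidueField))))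
    (w : iX ≫ f = (f₀ ≫ Spec.map (CommRingCat.ofHom (IsLocalization.Away.lift g (S := Localization.Away g)
        (isUnit_algebraMap_residueField_of_not_mem 𝔭 g hg)))) ≫
      Spec.map (CommRingCat.ofHom (algebraMap A (Localization.Away g)))) :
    IsPullback
      (pullback.lift iX (f₀ ≫ Spec.map (CommRingCat.ofHom (IsLocalization.Away.lift g (S := Localization.Away g)
        (isUnit_algebraMap_residueField_of_not_mem 𝔭 g hg)))) w)
      f₀ (pullback.snd f (Spec.map (CommRingCat.ofHom (algebraMap A (Localization.Away g)))))
      (Spec.map (CommRingCat.ofHom (IsLocalization.Away.lift g (S := Localization.Away g)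
        (isUnit_algebraMap_residueField_of_not_mem 𝔭 g hg)))) := by
  have big : IsPullback
      (pullback.lift iX (f₀ ≫ Spec.map (CommRingCat.ofHom (IsLocalization.Away.lift g (S := Localization.Away g)
        (isUnit_algebraMap_residueField_of_not_mem 𝔭 g hg)))) w ≫
        pullback.fst f (Spec.map (CommRingCat.ofHom (algebraMap A (Localization.Away g)))))
      f₀ f
      (Spec.map (CommRingCat.ofHom (IsLocalization.Away.lift g (S := Localization.Away g)
        (isUnit_algebraMap_residueField_of_not_mem 𝔭 g hg))) ≫
        Spec.map (CommRingCat.ofHom (algebraMap A (Localization.Away g)))) := by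
    rw [pullback.lift_fst, SpecMap_awayLift_comp 𝔭 g hg]
    exact HX
  exact IsPullback.of_right big (pullback.lift_snd _ _ _) (IsPullback.of_hasPullback f _)

/-- The hypothesis `w` of `isPullback_fibre_awayBaseChange` holds for the given square. [cite: EGAIII1, Prop. 4.6.7 (ii)] -/
theorem comp_eq_of_isPullback_fibre (hg : g ∉ 𝔭.asIdeal) {X X₀ : Scheme.{u}} (f : X ⟶ Spec (.of A))
    {iX : X₀ ⟶ X} {f₀ : X₀ ⟶ Spec (.of 𝔭.asIdeal.ResidueField)}
    (HX : IsPullback iX f₀ f (Spec.map (CommRingCat.ofHom (algebraMap A 𝔭.asIdeal.ResidueField)))) :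
    iX ≫ f = (f₀ ≫ Spec.map (CommRingCat.ofHom (IsLocalization.Away.lift g (S := Localization.Away g)
        (isUnit_algebraMap_residueField_of_not_mem 𝔭 g hg)))) ≫
      Spec.map (CommRingCat.ofHom (algebraMap A (Localization.Away g))) := by
  rw [Category.assoc, SpecMap_awayLift_comp 𝔭 g hg]
  exact HX.w

/-- The prime `𝔭A_g` of `A_g` lying over `𝔭` (`g ∉ 𝔭`). [cite: EGAIII1, Prop. 4.6.7 (ii)] -/
theorem exists_primeSpectrum_away_comap_eq (hg : g ∉ 𝔭.asIdeal) :
    ∃ 𝔭₁ : PrimeSpectrum (Localization.Away g), PrimeSpectrum.comap (algebraMap A (Localization.Away g)) 𝔭₁ = 𝔭 := by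
  have h : 𝔭 ∈ Set.range (PrimeSpectrum.comap (algebraMap A (Localization.Away g))) := by
    rw [PrimeSpectrum.localization_away_comap_range (Localization.Away g) g]
    exact hg
  exact h

/-- **`Spec κ(𝔭A_g) → Spec A_g` factors through `Spec κ(𝔭) → Spec A_g`.** For a prime `𝔭₁` of `A_g` over `𝔭`, the residue
field `κ(𝔭₁)` receives `κ(𝔭)` (Mathlib `Ideal.ResidueField.map`), compatibly with `A_g → κ(𝔭)`: this is the factorisation `σ`
required by ★ `Morphisms/ClosedImmersionNearFibreFlexible` / `RelativelyVeryAmpleNearFibre` § OverAlgebra to present the fibre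
of `X ×_A A_g` over `𝔭₁` by the original `X ×_A κ(𝔭)`. [cite: EGAIII1, Prop. 4.6.7 (ii)] -/
theorem exists_residueField_factor_awayLift (hg : g ∉ 𝔭.asIdeal) (𝔭₁ : PrimeSpectrum (Localization.Away g))
    (h𝔭₁ : PrimeSpectrum.comap (algebraMap A (Localization.Away g)) 𝔭₁ = 𝔭) :
    ∃ σ : Spec ((Spec (CommRingCat.of (Localization.Away g))).residueField 𝔭₁) ⟶ Spec (.of 𝔭.asIdeal.ResidueField),
      σ ≫ Spec.map (CommRingCat.ofHom (IsLocalization.Away.lift g (S := Localization.Away g)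
        (isUnit_algebraMap_residueField_of_not_mem 𝔭 g hg))) =
      (Spec (CommRingCat.of (Localization.Away g))).fromSpecResidueField 𝔭₁ := by
  have hcomap : 𝔭.asIdeal = 𝔭₁.asIdeal.comap (algebraMap A (Localization.Away g)) := by
    rw [← h𝔭₁]; rfl
  -- `κ(𝔭) → κ(𝔭₁)`
  set M : 𝔭.asIdeal.ResidueField →+* 𝔭₁.asIdeal.ResidueField :=
    Ideal.ResidueField.map 𝔭.asIdeal 𝔭₁.asIdeal (algebraMap A (Localization.Away g)) hcomap with hM
  -- `κ(𝔭) → κ(𝔭₁)` after `A_g → κ(𝔭)` is `A_g → κ(𝔭₁)`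
  have key : M.comp (IsLocalization.Away.lift g (S := Localization.Away g)
      (isUnit_algebraMap_residueField_of_not_mem 𝔭 g hg)) = algebraMap (Localization.Away g) 𝔭₁.asIdeal.ResidueField := by
    apply IsLocalization.ringHom_ext (Submonoid.powers g)
    rw [RingHom.comp_assoc, IsLocalization.Away.lift_comp]
    ext a
    rw [RingHom.comp_apply, hM, Ideal.ResidueField.map_algebraMap, RingHom.comp_apply]
  refine ⟨Spec.map (CommRingCat.ofHom M ≫ (Scheme.Spec.residueFieldIso (.of (Localization.Away g)) 𝔭₁).inv), ?_⟩
  rw [← Spec.map_comp, ← Category.assoc, ← CommRingCat.ofHom_comp, key, Spec.map_comp]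
  exact Scheme.Spec.map_residueFieldIso_inv_eq_fromSpecResidueField (.of (Localization.Away g)) 𝔭₁

end Away

end Literature.AlgebraicGeometry.Morphisms
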